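import Summits.BirchSwinnertonDyer.BirchSwinnertonDyer.Statement
import Summits.BirchSwinnertonDyer.BirchSwinnertonDyer.Theorems.SoloInformedJointGrossZagier
import Literature.NumberTheory.EllipticCurves.RegulatorProofs
import Literature.NumberTheory.EllipticCurves.GrossZagierRankOne
import Literature.NumberTheory.EllipticCurves.AnalyticRankOrderProofs
import Literature.NumberTheory.EllipticCurves.LeadingTerm
import Literature.NumberTheory.EllipticCurves.Selmer
import Literature.NumberTheory.EllipticCurves.BSDInvariants
import Mathlib.LinearAlgebra.Matrix.ToLinearEquiv
import HarnessLib
import HarnessLib.Audit.Tags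

/-!
# SoloInformedHigherGrossZagier — the archimedean receptacle `(Z_r)`, typed, and what it buys

The only transfer in print from the ORDER of vanishing of `L(E,s)` at `s = 1` to rational points
is the rank-one Gross–Zagier formula `L'(E,1) = c · ĥ(P)`, `c > 0` (tree fact
`WeierstrassCurve.gross_zagier_rank_one_rat`; Gross–Zagier, Invent. Math. 84 (1986) Thm. I.6.3
with §V.2): positivity of the Néron–Tate height turns `L'(E,1) ≠ 0` into a point of infinite
order. This file types the order-`r` analogue — the conjectural *higher Gross–Zagier identity*

  `(Z_r)`  `r_an(E) = r ⇒ ∃ P₁,…,P_r ∈ E(ℚ), c > 0 : L^{(r)}(E,1)/r! = c · det(⟨Pᵢ,Pⱼ⟩)`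

(`HigherGrossZagierRat r`; for `r = 1` it is literally the tree's rank-one fact,
`soloInformed_higherGrossZagier_one_iff`) and proves, sorry-free over named facts of the tree:

* `soloInformed_le_mordellWeilRank_of_higherGrossZagier`: `(Z_r) ⇒ LB_r`, i.e.
  `r_an(E) = r ⇒ r ≤ rank E(ℚ)`, from `L^{(r)}(E,1)/r! ≠ 0` (`leadingLCoeff_ne_zero_holds`, given
  the entire continuation `hasEntireLFunction_rat` = modularity) and the LINEAR ALGEBRA of the
  Néron–Tate pairing: a family with non-zero Gram determinant is `ℤ`-independent modulo torsion
  (`soloInformedJoint_linearIndependent_of_regulatorOf_ne_zero`: a dependence relation is an integer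
  kernel vector of the Gram matrix, since the pairing kills torsion), hence has at most `rank E(ℚ)`
  members (Mordell–Weil, `module_finite_point_holds`). No finiteness of `Ш` enters: the
  archimedean door produces the points that the Selmer lower door cannot.
* `soloInformed_rank_eq_of_higherGrossZagier_two_of_selmerDoor`: at `r_an = 2`, `(Z₂)` together
  with the Selmer UPPER door `corank Sel_{p^∞}(E/ℚ) ≤ 2` at one prime (door `(α)`: by Kato's
  Thm. 18.4 a consequence of `L_p''(E,0) ≠ 0`) gives `rank E(ℚ) = 2` AND `corank Ш(E/ℚ)[p^∞] = 0`
  — the `Ш`-door `(β)` of `SoloInformedRankTwo` becomes a consequence, not a hypothesis.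
* `soloInformed_birchSwinnertonDyer_of_higherGrossZagier_of_selmerDoor`: the summit
  `BirchSwinnertonDyer` follows from Gross–Zagier–Kolyvagin in analytic rank `≤ 1`
  (`rank_eq_analyticRank_of_analyticRank_le_one`), `(Z_r)` for every `r ≥ 2`, and the Selmer
  upper door for `r_an ≥ 2` ("Gross–Zagier–Kolyvagin one rank up, for every rank").
* `soloInformed_higherGrossZagier_instance_of_bsdTriple`: conversely `(Z_r)` for `E` is implied by
  the full BSD triple for `E` (RANK, `Ш` finite, LEAD) over the facts `bsdRHS_pos` and
  `exists_isMordellWeilBasis`: `(Z_r)` is a genuine intermediate, `BSD-triple ⇒ (Z_r) ⇒ LB_r`.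

What is NOT here is any construction of the points: for `r ≥ 2` no receptacle for `(Z_r)` exists
in print (Fornea–Gehrmann, arXiv:2102.09771, Rem. 1.1: the plectic determinant functional vanishes
on `∧² E(ℚ)`; Darmon–Fornea, arXiv:2310.16758, Conj. 3.9 and Remark 5), cf. the tree barrier
`Literature.Barriers.BirchSwinnertonDyer.plecticDeterminantVanishesOverQ_holds`.
-/

noncomputable section

open scoped Classical

open Literature.NumberTheory.EllipticCurves WeierstrassCurve WeierstrassCurve.Affine.Point Matrix

namespace Summit.BirchSwinnertonDyer.BirchSwinnertonDyer.Theorems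

/-- **`(Z_r)`, the higher Gross–Zagier identity over `ℚ` (conjectural for `r ≥ 2`).** If `E/ℚ`
has analytic rank `r` then there are rational points `P₁, …, P_r` and a real `c > 0` with
`L^{(r)}(E,1)/r! = c · det(⟨Pᵢ,Pⱼ⟩)ᵢⱼ` (Néron–Tate Gram determinant, `regulatorOf`). For `r = 1`
this is the Gross–Zagier formula with a non-vanishing twist (tree fact
`gross_zagier_rank_one_rat`, see `soloInformed_higherGrossZagier_one_iff`); for `r ≥ 2` it is the
shape of the BSD leading-term formula with `c = #Ш · Ω · ∏ c_p / #E(ℚ)_tors²` and `Pᵢ` a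
Mordell–Weil basis (`soloInformed_higherGrossZagier_instance_of_bsdTriple`), and no proof or
construction is known. A predicate indexed by `r`, never asserted.
[cite: GrossZagier1986, Thm. I.6.3 and §V.2] -/
@[conjecture]
def HigherGrossZagierRat (r : ℕ) : Prop :=
  ∀ (W : WeierstrassCurve ℚ) [W.IsElliptic], W.analyticRank = r →
    ∃ (P : Fin r → W.toAffine.Point) (c : ℝ), 0 < c ∧
      W.leadingLCoeff = ((c * regulatorOf P : ℝ) : ℂ)

/-! The lattice lemmas (the pairing kills torsion; non-zero Gram determinant ⇒ independence modulo
torsion; independent points bound the rank; `1 × 1` Gram determinants) are the landed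
`soloInformedJoint_*` declarations of `SoloInformedJointGrossZagier`, reused here. -/

/-- **`(Z_1)` is the rank-one Gross–Zagier fact of the tree.** `HigherGrossZagierRat 1` is
equivalent to `gross_zagier_rank_one_rat` (`L'(E,1) = c · ĥ(P)`, `c > 0`; Gross–Zagier 1986
Thm. I.6.3, §V.2 with a non-vanishing twist), via `det(⟨P,P⟩) = ĥ(P)`.
[cite: GrossZagier1986, Thm. I.6.3 and §V.2] -/
theorem soloInformed_higherGrossZagier_one_iff :
    HigherGrossZagierRat 1 ↔ gross_zagier_rank_one_rat := by
  constructor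
  · intro h W _ h1
    obtain ⟨P, c, hc, hL⟩ := h W h1
    refine ⟨P 0, c, hc, ?_⟩
    rw [hL, soloInformedJoint_regulatorOf_fin_one]
  · intro h W _ h1
    obtain ⟨P, c, hc, hL⟩ := h W h1
    refine ⟨fun _ => P, c, hc, ?_⟩
    rw [hL, soloInformedJoint_regulatorOf_fin_one]

/-- **`(Z_r) ⇒ LB_r`: the higher Gross–Zagier identity gives `r` independent points.** If
`(Z_r)` holds and `L(E,s)` is entire for every `E/ℚ` (modularity, `hasEntireLFunction_rat`), then
every `E/ℚ` of analytic rank `r` has `rank E(ℚ) ≥ r`: `L^{(r)}(E,1)/r! ≠ 0`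
(`leadingLCoeff_ne_zero_holds`) forces `det(⟨Pᵢ,Pⱼ⟩) ≠ 0`, hence independence modulo torsion
(`soloInformedJoint_linearIndependent_of_regulatorOf_ne_zero`), hence `r ≤ rank` (Mordell–Weil). The
rank-one case is Gross–Zagier's corollary `L'(E,1) ≠ 0 ⇒ rank E(ℚ) ≥ 1`.
[cite: GrossZagier1986, Thm. I.6.3 and §V.2] -/
theorem soloInformed_le_mordellWeilRank_of_higherGrossZagier {r : ℕ}
    (hZ : HigherGrossZagierRat r) (hE : hasEntireLFunction_rat)
    (W : WeierstrassCurve ℚ) [W.IsElliptic] (hr : W.analyticRank = r) :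
    r ≤ W.mordellWeilRank := by
  obtain ⟨P, c, hc, hL⟩ := hZ W hr
  have hne : W.leadingLCoeff ≠ 0 := leadingLCoeff_ne_zero_holds (W := W) (hE W)
  have hReg : regulatorOf P ≠ 0 := by
    intro h0
    apply hne
    rw [hL, h0, mul_zero, Complex.ofReal_zero]
  have hli := soloInformedJoint_linearIndependent_of_regulatorOf_ne_zero hReg
  simpa using soloInformedJoint_card_le_mordellWeilRank_of_linearIndependent hli

/-- **Gross–Zagier's corollary, re-derived through `(Z_1)`:** over `gross_zagier_rank_one_rat` and
modularity, `r_an(E) = 1 ⇒ rank E(ℚ) ≥ 1` (Gross–Zagier 1986, Thm. I.6.3 and §V.2; the upper bound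
is Kolyvagin's and is not claimed). A consistency check of the typing. [cite: GrossZagier1986, Thm. I.6.3 and §V.2] -/
theorem soloInformed_one_le_mordellWeilRank_of_grossZagier
    (hGZ : gross_zagier_rank_one_rat) (hE : hasEntireLFunction_rat)
    (W : WeierstrassCurve ℚ) [W.IsElliptic] (h1 : W.analyticRank = 1) :
    1 ≤ W.mordellWeilRank :=
  soloInformed_le_mordellWeilRank_of_higherGrossZagier
    (soloInformed_higherGrossZagier_one_iff.mpr hGZ) hE W h1

/-- **RANK at analytic rank two from `(Z₂)` and the Selmer upper door, with `Ш[p^∞]`-finiteness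
as OUTPUT.** Over `(Z₂)`, modularity and the corank identity
`corank Sel_{p^∞} = rank + corank Ш[p^∞]` (`selmerCorank_eq_mordellWeilRank_add`; Greenberg, LNM
1716 (1999) §1): if `r_an(E) = 2` and `corank_{ℤ_p} Sel_{p^∞}(E/ℚ) ≤ 2` at some prime `p` (door
`(α)`; by Kato, Astérisque 295 (2004) Thm. 18.4, implied by `ord_{T=0} L_p(E,T) ≤ 2` at a good
ordinary `p`), then `rank E(ℚ) = 2 = r_an(E)` and `corank_{ℤ_p} Ш(E/ℚ)[p^∞] = 0`.
[cite: GreenbergLNM1716, §1] -/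
theorem soloInformed_rank_eq_of_higherGrossZagier_two_of_selmerDoor
    (hZ : HigherGrossZagierRat 2) (hE : hasEntireLFunction_rat)
    (hSel : ∀ (W : WeierstrassCurve ℚ), W.selmerCorank_eq_mordellWeilRank_add)
    (W : WeierstrassCurve ℚ) [W.IsElliptic] (h2 : W.analyticRank = 2)
    (p : ℕ) [Fact p.Prime] (hα : W.selmerCorank p ≤ W.analyticRank) :
    W.mordellWeilRank = W.analyticRank ∧ W.shaCorank p = 0 := by
  have hLB : 2 ≤ W.mordellWeilRank :=
    soloInformed_le_mordellWeilRank_of_higherGrossZagier hZ hE W h2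
  have h' : W.selmerCorank_eq_mordellWeilRank_add := hSel W
  have hid : W.selmerCorank p = W.mordellWeilRank + W.shaCorank p := h' p
  constructor <;> omega

/-- **The summit from Gross–Zagier–Kolyvagin one rank up, for every rank.** `BirchSwinnertonDyer`
(`r_an(E) = rank E(ℚ)` for all `E/ℚ`) follows from: Gross–Zagier–Kolyvagin in analytic rank `≤ 1`
(`rank_eq_analyticRank_of_analyticRank_le_one`; Darmon, CBMS 101 (2004) Thm. 3.22), modularity
(`hasEntireLFunction_rat`), the corank identity (Greenberg 1999 §1), the higher Gross–Zagier
identity `(Z_r)` for every `r ≥ 2` (lower bounds: points from the leading coefficient) and the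
Selmer upper door `∃ p, corank Sel_{p^∞}(E/ℚ) ≤ r_an(E)` for `r_an ≥ 2` (upper bounds: by Kato's
Thm. 18.4 a statement about the order of vanishing of a `p`-adic `L`-function). Both remaining
inputs are open for every `r ≥ 2`; neither involves `Ш`. [cite: Darmon2004, Thm. 3.22 (= Thm. 1.14) and §3.9] -/
theorem soloInformed_birchSwinnertonDyer_of_higherGrossZagier_of_selmerDoor
    (hGZK : rank_eq_analyticRank_of_analyticRank_le_one)
    (hE : hasEntireLFunction_rat)
    (hSel : ∀ (W : WeierstrassCurve ℚ), W.selmerCorank_eq_mordellWeilRank_add)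
    (hZ : ∀ r : ℕ, 2 ≤ r → HigherGrossZagierRat r)
    (hα : ∀ (W : WeierstrassCurve ℚ) [W.IsElliptic], 2 ≤ W.analyticRank →
      ∃ (p : ℕ) (_ : Fact p.Prime), W.selmerCorank p ≤ W.analyticRank) :
    BirchSwinnertonDyer := by
  unfold BirchSwinnertonDyer Literature.BSDRankConjecture
  intro W hW
  by_cases h2 : 2 ≤ W.analyticRank
  · have hLB : W.analyticRank ≤ W.mordellWeilRank :=
      soloInformed_le_mordellWeilRank_of_higherGrossZagier (hZ _ h2) hE W rfl
    obtain ⟨p, hp, hle⟩ := hα W h2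
    have h' : W.selmerCorank_eq_mordellWeilRank_add := hSel W
    have hid : W.selmerCorank p = W.mordellWeilRank + W.shaCorank p := h' p
    omega
  · have h1 : W.analyticRank ≤ 1 := by omega
    exact (hGZK W h1).1.symm

/-- **`(Z_r)` is implied by the BSD triple: it is a genuine intermediate.** For an elliptic curve
`E/ℚ` satisfying RANK, `Ш` finite and LEAD (`W.BSDTriple`), over the facts `bsdRHS_pos`
(`#Ш · Reg · Ω · ∏ c_p / #tors² > 0` when `Ш` is finite) and existence of a Mordell–Weil basis
(`exists_isMordellWeilBasis`; Silverman AEC VIII.6), the instance of `(Z_{r_an})` for `E` holds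
with `Pᵢ` a Mordell–Weil basis and `c = bsdRHS / det(⟨Pᵢ,Pⱼ⟩) > 0` (the Gram determinant of a
basis is positive, `regulatorOf_pos_of_isMordellWeilBasis`, AEC Cor. VIII.9.7; it equals `Reg`, so
`c = #Ш · Ω · ∏ c_p / #tors²`, by the fact `regulatorOf_eq_regulator_of_isMordellWeilBasis`, not
needed here).
[cite: SilvermanAEC2009, Cor. VIII.9.7] -/
theorem soloInformed_higherGrossZagier_instance_of_bsdTriple (W : WeierstrassCurve ℚ)
    [W.IsElliptic] (hT : W.BSDTriple) (hRHS : W.bsdRHS_pos)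
    (hB : W.exists_isMordellWeilBasis) :
    ∃ (P : Fin W.analyticRank → W.toAffine.Point) (c : ℝ), 0 < c ∧
      W.leadingLCoeff = ((c * regulatorOf P : ℝ) : ℂ) := by
  obtain ⟨hRank, hSha, hLead⟩ := hT
  have hB' : ∃ P : Fin W.mordellWeilRank → W.toAffine.Point, IsMordellWeilBasis P := hB
  obtain ⟨P, hP⟩ := hB'
  have hpos : 0 < W.bsdRHS := hRHS hSha
  have hRegpos : 0 < regulatorOf P := regulatorOf_pos_of_isMordellWeilBasis hP
  have hRankEq : W.analyticRank = W.mordellWeilRank := hRank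
  let e : Fin W.mordellWeilRank ≃ Fin W.analyticRank := finCongr hRankEq.symm
  refine ⟨P ∘ e.symm, W.bsdRHS / regulatorOf P, div_pos hpos hRegpos, ?_⟩
  rw [regulatorOf_reindex, div_mul_cancel₀ _ hRegpos.ne']
  exact hLead

end Summit.BirchSwinnertonDyer.BirchSwinnertonDyer.Theorems

end
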